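import Mathlib
import HarnessLib
import Summits.ResolutionOfSingularities.ResolutionOfSingularities.Theorems.WildQuotientsWildQuotientResolutionCyclicModels
import Summits.ResolutionOfSingularities.ResolutionOfSingularities.Theorems.WildQuotientsWildQuotientResolutionCyclicTransfer
import Literature.AlgebraicGeometry.Resolution.ResolutionOfCurves
import Literature.AlgebraicGeometry.Resolution.ComponentGluing

/-!
# Terminal models ⟹ the cyclic wild quotient is resolved (crux stmt-ResolutionOfSingularities-15640
`WildQuotients.WildQuotientResolution`, line `Sketch`, R-layer composition of `L/w45c/CHAIN.md`)

[OURS · L1 W4.5c; NOT a statement of the manuscript.] The research Prop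
`CyclicTransfer.CyclicDivisorialModelsLE p₀ d` (p461350: existence of scheme-level
Király–Lütkebohmert terminal models for faithful actions of groups of prime order `p ≤ p₀` on
regular `X′` with `dim X₁ ≤ d`, `k` perfect) is turned into the EXACT remaining gap of the cyclic
sector of the crux in that range: composed with the cyclic divisorial transfer
(`CyclicTransfer.cyclicDivisorialTransfer`, p459590, unconditional) it yields the body of
`Theses.WildQuotients.CyclicWildQuotient` for `p ≤ p₀`, `topologicalKrullDim X₁ ≤ d` over perfect
fields (`cyclicWildQuotient_of_models`); with `(p₀, d) = (3, 4)` this is the first open case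
`CyclicQuotientFourfolds` (stmt-ResolutionOfSingularities-17941) for `p ≤ 3`
(`cyclicQuotientFourfolds_le_three_of_models`) — unconditionally in `p ≤ 3` once terminal
models exist there (the plain K–L game is only known to CYCLE for `p ≥ 5`,
`Lines/Sketch_NegativeDivisorialModels.md`). Degenerate cases handled here: `dim X₁ = 0`
(`hasResolution_of_dim_le_one`) and non-faithful `ρ` (then `G` acts trivially, `q` is bijective
and generically étale, hence birational by lemma (L), and the regular `X′` resolves `X₁`).
-/

-- single-problem summit: the doubled namespace component `ResolutionOfSingularities` is forced
set_option linter.dupNamespace false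

noncomputable section

open CategoryTheory Limits AlgebraicGeometry TopologicalSpace
open Literature.AlgebraicGeometry.Resolution

namespace Summit.ResolutionOfSingularities.ResolutionOfSingularities.Theorems.WildQuotientResolution.CyclicTransfer

/-- **Terminal models for `p ≤ p₀`, `dim ≤ d` give the cyclic wild quotient there** (R-layer
composition of chain w45c): assuming `CyclicDivisorialModelsLE p₀ d`, for every prime `p ≤ p₀`,
perfect field `k` of characteristic `p` and crux data `(X′, X₁, q, G, ρ)` with `Nat.card G = p`
and `topologicalKrullDim X₁ ≤ d`, the quotient `X₁` has a resolution of singularities. If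
`dim X₁ = 0`, by `hasResolution_of_dim_le_one`; if `ρ` is not faithful, its kernel is all of the
prime-order `G`, the fibres of `q` (the orbits) are points, so `q` is finite surjective
generically étale and injective, hence birational (`Birational.stub_birational_of_bijective`),
and `X′` (regular) resolves `X₁`; otherwise the hypothesis supplies a `G`-equivariant regular
terminal model `V → X′` and `cyclicDivisorialTransfer` concludes. [folklore; assembly of landed
decls] -/
theorem cyclicWildQuotient_of_models (p₀ d : ℕ) (h : CyclicDivisorialModelsLE p₀ d) :
    ∀ p : ℕ, p.Prime → p ≤ p₀ → ∀ (k : Type) [Field k] [CharP k p] [PerfectField k]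
      (X' X₁ : Scheme.{0}) (f : X₁ ⟶ Spec (.of k)) (q : X' ⟶ X₁) (G : Type) [Group G] [Finite G]
      (ρ : G →* Aut X'), Nat.card G = p → IsSeparated f → LocallyOfFiniteType f → QuasiCompact f →
      IsIntegral X₁ → IsIntegral X' → Scheme.IsRegular X' → IsFinite q → Function.Surjective q.base →
      (∃ U : X₁.Opens, Dense (U : Set X₁) ∧ Etale (q ∣_ U)) → (∀ g : G, (ρ g).hom ≫ q = q) →
      (∀ x y : X', q.base x = q.base y → ∃ g : G, (ρ g).hom.base x = y) →
      topologicalKrullDim X₁ ≤ d → Scheme.HasResolution X₁ := by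
  intro p hp hpp₀ k _ _ _ X' X₁ f q G _ _ ρ hcard hsep hlft hqc hX₁ hX' hreg hfin hsurj hU hρ horb
    hdim
  classical
  haveI := hsep
  haveI := hlft
  haveI := hqc
  haveI := hX₁
  haveI := hX'
  haveI := hfin
  -- dimension zero
  by_cases hdim0 : topologicalKrullDim X₁ ≤ 0
  · exact hasResolution_of_dim_le_one X₁ f (hdim0.trans zero_le_one)
  by_cases hfaith : Function.Injective ρ
  · -- faithful: the hypothesis supplies a terminal model, and the transfer concludes
    obtain ⟨V, π, ρV, hπ, hbir, hV, hVreg, hequiv, hcov, hdiv⟩ :=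
      h p hp hpp₀ k X' X₁ f q G ρ hcard hfaith hsep hlft hqc hX₁ hX' hreg hfin hρ hdim
    haveI := hπ
    haveI := hV
    exact cyclicDivisorialTransfer p hp k X' X₁ f q G ρ hcard hfaith hdim0 hsurj hU hρ horb V π ρV
      hbir hVreg hequiv hcov hdiv
  · -- not faithful: `G` of prime order acts trivially, `q` is birational, `X′` resolves `X₁`
    haveI : Fact (Nat.card G).Prime := ⟨hcard ▸ hp⟩
    have hker : ρ.ker = ⊤ := by
      rcases ρ.ker.eq_bot_or_eq_top_of_prime_card with h' | h'
      · exact absurd ((MonoidHom.ker_eq_bot_iff ρ).mp h') hfaith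
      · exact h'
    have htriv : ∀ g : G, ρ g = 1 := fun g => by
      have hg : g ∈ ρ.ker := hker ▸ Subgroup.mem_top g
      exact hg
    have hinj : Function.Injective q.base := fun x y hxy => by
      obtain ⟨g, hg⟩ := horb x y hxy
      rw [htriv g] at hg
      exact hg
    obtain ⟨U, hUd, hUet⟩ := hU
    haveI := hUet
    have hbij : Function.Bijective (q ∣_ U).base := by
      rw [morphismRestrict_base]
      exact Set.restrictPreimage_bijective _ ⟨hinj, hsurj⟩
    have hqbir : IsBirational q := Birational.stub_birational_of_bijective k f q hdim0 U hUd hbij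
    exact ComponentGluing.Scheme.HasResolution.of_isBirational q hqbir hreg.hasResolution

/-- **The first open case for `p ≤ 3` from terminal models in dimension `≤ 4`** (R-layer rung
of chain w45c): `CyclicDivisorialModelsLE 3 4` — existence of Király–Lütkebohmert terminal
models for faithful actions of `ℤ/2` and `ℤ/3` on regular `X′` with `dim X₁ ≤ 4` over perfect
fields (OPEN; the plain equivariant K–L blow-up game is only known to cycle for `p ≥ 5`) —
implies the body of `Theses.WildQuotients.CyclicQuotientFourfolds`
(stmt-ResolutionOfSingularities-17941) restricted to `p ≤ 3`, with NO Bergh–Rydh input.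
[folklore; `cyclicWildQuotient_of_models 3 4`] -/
theorem cyclicQuotientFourfolds_le_three_of_models (h : CyclicDivisorialModelsLE 3 4) :
    ∀ p : ℕ, p.Prime → p ≤ 3 → ∀ (k : Type) [Field k] [CharP k p] [PerfectField k]
      (X' X₁ : Scheme.{0}) (f : X₁ ⟶ Spec (.of k)) (q : X' ⟶ X₁) (G : Type) [Group G] [Finite G]
      (ρ : G →* Aut X'), Nat.card G = p → IsSeparated f → LocallyOfFiniteType f → QuasiCompact f →
      IsIntegral X₁ → IsIntegral X' → Scheme.IsRegular X' → IsFinite q → Function.Surjective q.base →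
      (∃ U : X₁.Opens, Dense (U : Set X₁) ∧ Etale (q ∣_ U)) → (∀ g : G, (ρ g).hom ≫ q = q) →
      (∀ x y : X', q.base x = q.base y → ∃ g : G, (ρ g).hom.base x = y) →
      topologicalKrullDim X₁ ≤ 4 → Scheme.HasResolution X₁ :=
  cyclicWildQuotient_of_models 3 4 h

end Summit.ResolutionOfSingularities.ResolutionOfSingularities.Theorems.WildQuotientResolution.CyclicTransfer

end
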